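import Literature.Probability.LatticeModels.MessagerMiracleSoleFree
import Literature.Probability.LatticeModels.RegularScales
import HarnessLib

/-!
# Good switch points for an arbitrary far source (Aizenman–Duminil-Copin 2021, §6.2, the sets `𝔸_y(m)` and Remark 6.5)

Topic `Literature/Probability/LatticeModels`. Definitions with bodies and theorems; **no named fact is
introduced** (D-0026).

M. Aizenman, H. Duminil-Copin, Ann. of Math. **194** (2021) = arXiv:1912.07973, §6.2 (p. 23): "To define
`𝐍`, first introduce for every vertex `y ∉ Λ_{2dm}` the set
`𝔸_y(m) := {u ∈ Ann(m,2m) : ∀ x ∈ Λ_{m/d}, ⟨σ_xσ_y⟩ ≤ (1 + C|x-u|/|y|)⟨σ_uσ_y⟩}` …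
**Remark 6.5.** … since `y` will not a priori be assumed to belong to a regular scale (in fact `|y|` may
be much larger than `ξ(β)` when `β < β_c`), we will use the inequality between `⟨σ_xσ_y⟩` and `⟨σ_uσ_y⟩`
in several bounds. Now, if `y₁ = |y|`, then `𝔸_y(m) ⊃ {z ∈ ℤ^d : m ≤ z₁ ≤ 2m and 0 ≤ z_j ≤ m/d for j > 1}`
as the Messager–Miracle-Solé inequality implies that `⟨σ_zσ_y⟩ ≥ ⟨σ_xσ_y⟩` for every `x ∈ Λ_{m/d}`."

What the proof of Theorem 6.4 uses of `𝔸_y(m)` for an ARBITRARY far `y` is a large explicit subset of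
`Ann(m,2m)` on which the far two-point function DOMINATES its values near the centre. This file constructs
one for every direction of `y` (the printed quadrant is the case of `y` on a positive coordinate axis; for a
general direction the transverse offsets must be taken on the side of `y`, coordinate by coordinate) and
proves the domination from the Messager–Miracle-Solé monotonicity of the free two-point function
(`MessagerMiracleSoleFree`: axis and diagonal forms, signed-permutation invariance), valid for all `β ≥ 0`:

* `goodCorner y i₀ m w`, `goodCube y i₀ m w` — the cube `c + [0,w]^d` of switch points: along the dominant
  axis `i₀` of `y` (`|y_{i₀}| = ‖y‖_∞`) at signed heights `[m, m+w]`, transversally at signed offsets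
  `[w, 2w]` on the side of `y_j` when `|y_j| ≥ 2w` and at `[0, w]` when `|y_j| < 2w`;
* `card_goodCube` — it has `(w+1)^d` points; `goodCube_subset_ann` — it lies in `Ann(m, 2m)` (`2w ≤ m`);
* `twoPointFree_sub_le_of_mem_goodCube` — **domination**: for `β ≥ 0`, `2dw ≤ m`, `‖y‖_∞ ≥ 4m`,
  every `z` of the cube and every `x ∈ Λ_w`: `⟨σ_xσ_y⟩ ≤ ⟨σ_zσ_y⟩`, i.e. `S(y - x) ≤ S(y - z)`
  (`S = twoPointFree d β`), by a chain of Messager–Miracle-Solé moves from `y - z` to `y - x`: the large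
  transverse coordinates move away from `0` along their own axes (`twoPointFree_add_single_signed_le`), the
  small ones by diagonal moves paid from the budget `|z_{i₀}| - |x_{i₀}| ≥ m - w` along the dominant axis
  (`twoPointFree_add_diag_iter_le`), the rest of the budget along the dominant axis.

## References

* M. Aizenman, H. Duminil-Copin, Ann. of Math. 194 (2021), arXiv:1912.07973, §6.2, definition of `𝔸_y(m)`
  and Remark 6.5 with its footnote (p. 23) [AizenmanDuminilCopinAnnals2021].
* A. Messager, S. Miracle-Solé, J. Stat. Phys. 17 (1977); G. Hegerfeldt, Comm. Math. Phys. 57 (1977) —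
  through `MessagerMiracleSoleFree` [MessagerMiracleSoleJSP1977] [Hegerfeldt1977].
-/

noncomputable section

open Finset

namespace Literature.Probability.LatticeModels

variable {d : ℕ} {β : ℝ}

/-! ### Signed Messager–Miracle-Solé moves -/

/-- **Axis move away from the origin, either sign**: for `σ = ±1` and `σ pᵢ ≥ 0`,
`S(p + σ t eᵢ) ≤ S(p)` (`twoPointFree_add_single_le` and the reflection `xᵢ ↦ -xᵢ`). [cite: MessagerMiracleSoleJSP1977, main theorem (monotonicity of ⟨σ₀σ_x⟩ under reflections)] -/
theorem twoPointFree_add_single_signed_le (hβ : 0 ≤ β) (p : Site d) (i : Fin d) {σ : ℤ}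
    (hσ : σ = 1 ∨ σ = -1) (hp : 0 ≤ σ * p i) (t : ℕ) :
    twoPointFree d β (p + Pi.single i (σ * t)) ≤ twoPointFree d β p := by
  rcases hσ with rfl | rfl
  · rw [one_mul]
    exact twoPointFree_add_single_le hβ p i (by linarith) t
  · set q : Site d := p + Pi.single i (-1 * (t : ℤ)) with hq
    have hp' : 0 ≤ (Function.update p i (-p i)) i := by rw [Function.update_self]; linarith
    have h := twoPointFree_add_single_le hβ (Function.update p i (-p i)) i hp' t
    rw [twoPointFree_reflection hβ i p] at h
    have heq : Function.update p i (-p i) + Pi.single i (t : ℤ) = Function.update q i (-q i) := by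
      ext k
      by_cases hk : k = i
      · subst hk
        simp only [hq, Pi.add_apply, Function.update_self, Pi.single_eq_same]
        ring
      · simp only [hq, Pi.add_apply, Function.update_of_ne hk, Pi.single_eq_of_ne hk, add_zero]
    rw [heq, twoPointFree_reflection hβ] at h
    exact h

/-- The diagonal move with `σ = 1`: for `τ = ±1`, `i ≠ j` and `-τ pⱼ ≤ pᵢ`, `S(p + eᵢ + τ eⱼ) ≤ S(p)`
(`messager_miracleSole_diag_free` and the reflection `xⱼ ↦ -xⱼ`). [cite: Hegerfeldt1977, Thm. 3.2, eq. (3.10)] -/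
theorem twoPointFree_add_diag_le_aux (hβ : 0 ≤ β) (p : Site d) {i j : Fin d} (hij : i ≠ j) {τ : ℤ}
    (hτ : τ = 1 ∨ τ = -1) (hcone : -τ * p j ≤ p i) :
    twoPointFree d β (p + Pi.single i 1 + Pi.single j τ) ≤ twoPointFree d β p := by
  rcases hτ with rfl | rfl
  · -- reflect the coordinate `j`
    set q : Site d := p + Pi.single i 1 + Pi.single j 1 with hq
    set p' : Site d := Function.update p j (-p j) with hp'
    have hcone' : p' j ≤ p' i := by
      rw [hp', Function.update_self, Function.update_of_ne hij]; linarith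
    have h := messager_miracleSole_diag_free hβ p' hij hcone'
    rw [hp', twoPointFree_reflection hβ j p] at h
    have heq : Function.update p j (-p j) + Pi.single i 1 - Pi.single j 1 = Function.update q j (-q j) := by
      ext k
      by_cases hk : k = j
      · subst hk
        simp only [hq, Pi.add_apply, Pi.sub_apply, Function.update_self, Pi.single_eq_same,
          Pi.single_eq_of_ne hij.symm]
        ring
      · by_cases hki : k = i
        · subst hki
          simp only [hq, Pi.add_apply, Pi.sub_apply, Function.update_of_ne hk, Pi.single_eq_same,
            Pi.single_eq_of_ne hk]
          ring
        · simp only [hq, Pi.add_apply, Pi.sub_apply, Function.update_of_ne hk, Pi.single_eq_of_ne hk,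
            Pi.single_eq_of_ne hki, add_zero, sub_zero]
    rw [heq, twoPointFree_reflection hβ] at h
    exact h
  · have hcone' : p j ≤ p i := by linarith
    have h := messager_miracleSole_diag_free hβ p hij hcone'
    have heq : p + Pi.single i 1 - Pi.single j 1 = p + Pi.single i 1 + Pi.single j (-1) := by
      rw [Pi.single_neg, sub_eq_add_neg]
    rw [heq] at h
    exact h

/-- **Diagonal move, all signs**: for `σ, τ = ±1`, `i ≠ j` and `-τ pⱼ ≤ σ pᵢ`,
`S(p + σ eᵢ + τ eⱼ) ≤ S(p)` — moving one step away from the origin along the axis `i` pays for one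
transverse step. [cite: Hegerfeldt1977, Thm. 3.2, eq. (3.10)] -/
theorem twoPointFree_add_diag_le (hβ : 0 ≤ β) (p : Site d) {i j : Fin d} (hij : i ≠ j) {σ τ : ℤ}
    (hσ : σ = 1 ∨ σ = -1) (hτ : τ = 1 ∨ τ = -1) (hcone : -τ * p j ≤ σ * p i) :
    twoPointFree d β (p + Pi.single i σ + Pi.single j τ) ≤ twoPointFree d β p := by
  rcases hσ with rfl | rfl
  · exact twoPointFree_add_diag_le_aux hβ p hij hτ (by linarith)
  · -- reflect the coordinate `i`
    set q : Site d := p + Pi.single i (-1) + Pi.single j τ with hq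
    set p' : Site d := Function.update p i (-p i) with hp'
    have hcone' : -τ * p' j ≤ p' i := by
      rw [hp', Function.update_self, Function.update_of_ne hij.symm]; linarith
    have h := twoPointFree_add_diag_le_aux hβ p' hij hτ hcone'
    rw [hp', twoPointFree_reflection hβ i p] at h
    have heq : Function.update p i (-p i) + Pi.single i 1 + Pi.single j τ = Function.update q i (-q i) := by
      ext k
      by_cases hk : k = i
      · subst hk
        simp only [hq, Pi.add_apply, Function.update_self, Pi.single_eq_same, Pi.single_eq_of_ne hij]
        ring
      · by_cases hkj : k = j
        · subst hkj
          simp only [hq, Pi.add_apply, Function.update_of_ne hk, Pi.single_eq_same, Pi.single_eq_of_ne hk]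
        · simp only [hq, Pi.add_apply, Function.update_of_ne hk, Pi.single_eq_of_ne hk, Pi.single_eq_of_ne hkj,
            add_zero]
    rw [heq, twoPointFree_reflection hβ] at h
    exact h

/-- **Iterated diagonal moves** under the cone condition `|pⱼ| ≤ σ pᵢ`: for every `t`,
`S(p + σ t eᵢ + τ t eⱼ) ≤ S(p)`. [cite: Hegerfeldt1977, Thm. 3.2, eq. (3.10)] -/
theorem twoPointFree_add_diag_iter_le (hβ : 0 ≤ β) (p : Site d) {i j : Fin d} (hij : i ≠ j) {σ τ : ℤ}
    (hσ : σ = 1 ∨ σ = -1) (hτ : τ = 1 ∨ τ = -1) (hcone : |p j| ≤ σ * p i) (t : ℕ) :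
    twoPointFree d β (p + Pi.single i (σ * t) + Pi.single j (τ * t)) ≤ twoPointFree d β p := by
  induction t with
  | zero => simp
  | succ t ih =>
    set q : Site d := p + Pi.single i (σ * t) + Pi.single j (τ * t) with hq
    have hqj : q j = p j + τ * t := by rw [hq]; simp [Pi.single_eq_of_ne hij.symm]
    have hqi : q i = p i + σ * t := by rw [hq]; simp [Pi.single_eq_of_ne hij]
    have hτp : -τ * p j ≤ |p j| := by
      rcases hτ with rfl | rfl
      · have := neg_abs_le (p j); linarith
      · have := le_abs_self (p j); linarith
    have hσσ : σ * σ = 1 := by rcases hσ with rfl | rfl <;> norm_num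
    have hττ : τ * τ = 1 := by rcases hτ with rfl | rfl <;> norm_num
    have hcone' : -τ * q j ≤ σ * q i := by
      rw [hqj, hqi]
      have h1 : -τ * (p j + τ * t) = -τ * p j - (τ * τ) * t := by ring
      have h2 : σ * (p i + σ * t) = σ * p i + (σ * σ) * t := by ring
      rw [h1, h2, hσσ, hττ]
      have ht : (0 : ℤ) ≤ t := by positivity
      linarith
    have h := twoPointFree_add_diag_le hβ q hij hσ hτ hcone'
    have heq : q + Pi.single i σ + Pi.single j τ =
        p + Pi.single i (σ * ((t + 1 : ℕ) : ℤ)) + Pi.single j (τ * ((t + 1 : ℕ) : ℤ)) := by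
      rw [hq]
      ext k
      simp only [Pi.add_apply, Pi.single_apply]
      push_cast
      split_ifs <;> ring
    rw [heq] at h
    exact h.trans ih

/-- **Step A of the chain**: changing the coordinates of a set `B` by amounts of the sign of the
coordinate (moving away from the origin along each axis of `B`) decreases `S`. [cite: MessagerMiracleSoleJSP1977, main theorem (monotonicity of ⟨σ₀σ_x⟩ under reflections)] -/
theorem twoPointFree_le_of_axis_moves (hβ : 0 ≤ β) (σ : Fin d → ℤ) (p : Site d) :
    ∀ (B : Finset (Fin d)) (q : Site d), (∀ j ∈ B, σ j = 1 ∨ σ j = -1) → (∀ j ∈ B, 0 ≤ σ j * p j) →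
      (∀ j ∈ B, 0 ≤ σ j * (q j - p j)) → (∀ j, j ∉ B → q j = p j) →
      twoPointFree d β q ≤ twoPointFree d β p := by
  intro B
  induction B using Finset.induction_on with
  | empty =>
    intro q _ _ _ hq
    have : q = p := funext fun j => hq j (by simp)
    rw [this]
  | @insert j B hjB ih =>
    intro q hσ hp hq hoff
    -- undo the coordinate `j`
    set q' : Site d := Function.update q j (p j) with hq'
    have h1 : twoPointFree d β q' ≤ twoPointFree d β p := by
      refine ih q' (fun k hk => hσ k (mem_insert_of_mem hk)) (fun k hk => hp k (mem_insert_of_mem hk))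
        (fun k hk => ?_) (fun k hk => ?_)
      · have hkj : k ≠ j := fun h => hjB (h ▸ hk)
        rw [hq', Function.update_of_ne hkj]; exact hq k (mem_insert_of_mem hk)
      · by_cases hkj : k = j
        · subst hkj; rw [hq', Function.update_self]
        · rw [hq', Function.update_of_ne hkj]; exact hoff k (by simp [hkj, hk])
    -- redo it as a signed axis move from `q'`
    have hσj := hσ j (mem_insert_self j B)
    have hσσ : σ j * σ j = 1 := by rcases hσj with h | h <;> rw [h] <;> norm_num
    set t : ℕ := (σ j * (q j - p j)).toNat with ht
    have htq : (t : ℤ) = σ j * (q j - p j) := by rw [ht, Int.toNat_of_nonneg (hq j (mem_insert_self j B))]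
    have heq : q = q' + Pi.single j (σ j * t) := by
      ext k
      by_cases hkj : k = j
      · subst hkj
        rw [Pi.add_apply, hq', Function.update_self, Pi.single_eq_same, htq, ← mul_assoc, hσσ, one_mul]
        ring
      · rw [Pi.add_apply, hq', Function.update_of_ne hkj, Pi.single_eq_of_ne hkj, add_zero]
    have hpj : 0 ≤ σ j * q' j := by rw [hq', Function.update_self]; exact hp j (mem_insert_self j B)
    have h2 := twoPointFree_add_single_signed_le hβ q' j hσj hpj t
    rw [← heq] at h2
    exact h2.trans h1

/-- **Step B of the chain**: changing the coordinates of a set `B ∌ i₀` arbitrarily while moving away from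
the origin along the axis `i₀` by the total transverse displacement decreases `S`, under the cone condition
`|pⱼ| ≤ σ p_{i₀}` (`j ∈ B`). [cite: Hegerfeldt1977, Thm. 3.2, eq. (3.10)] -/
theorem twoPointFree_le_of_diag_moves (hβ : 0 ≤ β) {i₀ : Fin d} {σ : ℤ} (hσ : σ = 1 ∨ σ = -1) (p : Site d) :
    ∀ (B : Finset (Fin d)) (q : Site d), i₀ ∉ B → (∀ j ∈ B, |p j| ≤ σ * p i₀) →
      q i₀ = p i₀ + σ * ∑ j ∈ B, |q j - p j| → (∀ j, j ∉ B → j ≠ i₀ → q j = p j) →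
      twoPointFree d β q ≤ twoPointFree d β p := by
  intro B
  induction B using Finset.induction_on with
  | empty =>
    intro q _ _ hqi hq
    have : q = p := by
      funext j
      by_cases hj : j = i₀
      · subst hj; rw [hqi]; simp
      · exact hq j (by simp) hj
    rw [this]
  | @insert j B hjB ih =>
    intro q hi₀ hcone hqi hoff
    have hji : j ≠ i₀ := fun h => hi₀ (h ▸ mem_insert_self j B)
    have hi₀B : i₀ ∉ B := fun h => hi₀ (mem_insert_of_mem h)
    -- undo the coordinate `j` and its share of the budget
    set q' : Site d := Function.update (Function.update q j (p j)) i₀ (p i₀ + σ * ∑ k ∈ B, |q k - p k|) with hq'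
    have hq'i : q' i₀ = p i₀ + σ * ∑ k ∈ B, |q k - p k| := by rw [hq', Function.update_self]
    have hq'j : q' j = p j := by rw [hq', Function.update_of_ne hji, Function.update_self]
    have hq'k : ∀ k, k ≠ j → k ≠ i₀ → q' k = q k := fun k hkj hki => by
      rw [hq', Function.update_of_ne hki, Function.update_of_ne hkj]
    have hsum : ∑ k ∈ B, |q' k - p k| = ∑ k ∈ B, |q k - p k| := by
      refine Finset.sum_congr rfl fun k hk => ?_
      rw [hq'k k (fun h => hjB (h ▸ hk)) (fun h => hi₀B (h ▸ hk))]
    have h1 : twoPointFree d β q' ≤ twoPointFree d β p := by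
      refine ih q' hi₀B (fun k hk => hcone k (mem_insert_of_mem hk)) (by rw [hq'i, hsum]) fun k hk hki => ?_
      by_cases hkj : k = j
      · subst hkj; exact hq'j
      · rw [hq'k k hkj hki]; exact hoff k (by simp [hkj, hk]) hki
    -- redo it as an iterated diagonal move from `q'`
    set t : ℕ := (q j - p j).natAbs with ht
    set τ : ℤ := if p j ≤ q j then 1 else -1 with hτ
    have hτ1 : τ = 1 ∨ τ = -1 := by rw [hτ]; split_ifs <;> simp
    have hτt : τ * (t : ℤ) = q j - p j := by
      rw [hτ, ht]
      split_ifs with h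
      · rw [one_mul, Int.natAbs_of_nonneg (by linarith)]
      · rw [Int.ofNat_natAbs_of_nonpos (by linarith)]; ring
    have habs : |q j - p j| = (t : ℤ) := by rw [ht, Int.natCast_natAbs]
    have heq : q = q' + Pi.single i₀ (σ * t) + Pi.single j (τ * t) := by
      ext k
      by_cases hki : k = i₀
      · subst hki
        rw [Pi.add_apply, Pi.add_apply, hq'i, Pi.single_eq_same, Pi.single_eq_of_ne hji.symm, add_zero, hqi,
          Finset.sum_insert hjB, habs]
        ring
      · by_cases hkj : k = j
        · subst hkj
          rw [Pi.add_apply, Pi.add_apply, hq'j, Pi.single_eq_of_ne hji, Pi.single_eq_same, add_zero, hτt]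
          ring
        · rw [Pi.add_apply, Pi.add_apply, hq'k k hkj hki, Pi.single_eq_of_ne hki, Pi.single_eq_of_ne hkj,
            add_zero, add_zero]
    have hcone' : |q' j| ≤ σ * q' i₀ := by
      rw [hq'j, hq'i, mul_add]
      have hσσ : σ * σ = 1 := by rcases hσ with h | h <;> rw [h] <;> norm_num
      have h0 : 0 ≤ σ * (σ * ∑ k ∈ B, |q k - p k|) := by
        rw [← mul_assoc, hσσ, one_mul]; exact Finset.sum_nonneg fun k _ => abs_nonneg _
      linarith [hcone j (mem_insert_self j B)]
    have h2 := twoPointFree_add_diag_iter_le hβ q' (Ne.symm hji) hσ hτ1 hcone' t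
    rw [← heq] at h2
    exact h2.trans h1

/-! ### The cube of good switch points -/

/-- The corner of the cube of good switch points for the far source `y` with dominant axis `i₀`, scale `m`
and width `w`: signed height `m` (resp. `-(m+w)`) along `i₀`, signed offset `w` (resp. `-2w`) in the
transverse coordinates with `|y_j| ≥ 2w`, and `0` in the others. [cite: AizenmanDuminilCopinAnnals2021, arXiv:1912.07973 §6.2, Remark 6.5 (the quadrant, p. 23)] -/
def goodCorner (y : Site d) (i₀ : Fin d) (m w : ℕ) : Site d := fun j =>
  if j = i₀ then (if 0 ≤ y j then (m : ℤ) else -((m : ℤ) + w))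
  else if (2 * w : ℤ) ≤ |y j| then (if 0 ≤ y j then (w : ℤ) else -(2 * (w : ℤ))) else 0

/-- **The cube of good switch points** `goodCorner + [0,w]^d` (the printed quadrant
`{m ≤ z₁ ≤ 2m, 0 ≤ z_j ≤ m/d}` is the case `y = |y|e₁`, up to the harmless choice of widths).
[cite: AizenmanDuminilCopinAnnals2021, arXiv:1912.07973 §6.2, Remark 6.5 (p. 23)] -/
def goodCube (y : Site d) (i₀ : Fin d) (m w : ℕ) : Finset (Site d) :=
  (Fintype.piFinset fun _ : Fin d => Finset.Icc (0 : ℤ) w).image fun t => goodCorner y i₀ m w + t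

/-- Membership in the cube. [folklore] -/
theorem mem_goodCube_iff {y : Site d} {i₀ : Fin d} {m w : ℕ} {z : Site d} :
    z ∈ goodCube y i₀ m w ↔ ∀ j, 0 ≤ z j - goodCorner y i₀ m w j ∧ z j - goodCorner y i₀ m w j ≤ w := by
  unfold goodCube
  rw [Finset.mem_image]
  constructor
  · rintro ⟨t, ht, rfl⟩ j
    rw [Fintype.mem_piFinset] at ht
    have := ht j
    rw [Finset.mem_Icc] at this
    simp [this.1, this.2]
  · intro h
    refine ⟨fun j => z j - goodCorner y i₀ m w j, ?_, ?_⟩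
    · rw [Fintype.mem_piFinset]
      intro j
      rw [Finset.mem_Icc]
      exact h j
    · funext j; simp

/-- **The cube has `(w+1)^d` points.** [folklore] -/
theorem card_goodCube (y : Site d) (i₀ : Fin d) (m w : ℕ) : #(goodCube y i₀ m w) = (w + 1) ^ d := by
  unfold goodCube
  rw [Finset.card_image_of_injective _ (add_right_injective _), Fintype.card_piFinset]
  simp [Int.card_Icc]

/-- **The cube lies in the annulus `Ann(m, 2m)`** when `2w ≤ m` and `i₀` is a coordinate (any `d ≥ 1`).
[cite: AizenmanDuminilCopinAnnals2021, arXiv:1912.07973 §6.2, Remark 6.5 (p. 23)] -/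
theorem goodCube_subset_ann (y : Site d) (i₀ : Fin d) {m w : ℕ} (hw : 2 * w ≤ m) :
    goodCube y i₀ m w ⊆ ann d m (2 * m) := by
  intro z hz
  rw [mem_goodCube_iff] at hz
  rw [mem_ann]
  have hi := hz i₀
  have hlow : m ≤ (z i₀).natAbs ∧ (z i₀).natAbs ≤ 2 * m := by
    unfold goodCorner at hi
    simp only [if_true] at hi
    split_ifs at hi with h <;> omega
  constructor
  · exact hlow.1.trans (Site.natAbs_le_supNorm z i₀)
  · rw [Site.supNorm_le_iff]
    intro j
    by_cases hj : j = i₀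
    · subst hj; exact hlow.2
    · have h := hz j
      unfold goodCorner at h
      simp only [hj, if_false] at h
      split_ifs at h <;> omega

/-- **Domination on the cube** (the role of `𝔸_y(m)`): for `β ≥ 0`, a far source `y` with dominant axis
`i₀` (`|y_{i₀}| = ‖y‖_∞ ≥ 4m`) and `2dw ≤ m`, every `z` of the cube and every `x ∈ Λ_w` satisfy
`⟨σ_xσ_y⟩ ≤ ⟨σ_zσ_y⟩`, i.e. `S(y - x) ≤ S(y - z)` — "the Messager–Miracle-Solé inequality implies that
`⟨σ_zσ_y⟩ ≥ ⟨σ_xσ_y⟩` for every `x ∈ Λ_{m/d}`". [cite: AizenmanDuminilCopinAnnals2021, arXiv:1912.07973 §6.2, Remark 6.5 and its footnote (p. 23)] -/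
theorem twoPointFree_sub_le_of_mem_goodCube (hβ : 0 ≤ β) {y : Site d} {i₀ : Fin d}
    (hi₀ : (y i₀).natAbs = Site.supNorm y) {m w : ℕ} (hw : 2 * d * w ≤ m) (hy : 4 * m ≤ Site.supNorm y)
    {z : Site d} (hz : z ∈ goodCube y i₀ m w) {x : Site d} (hx : x ∈ box d w) :
    twoPointFree d β (y - x) ≤ twoPointFree d β (y - z) := by
  have hd : 1 ≤ d := Nat.one_le_iff_ne_zero.2 fun h => by subst h; exact Fin.elim0 i₀
  have hwm : 2 * w ≤ m := le_trans (Nat.mul_le_mul_right w (by omega : 2 ≤ 2 * d)) hw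
  rw [mem_goodCube_iff] at hz
  rw [mem_box] at hx
  -- signs and the two transverse classes
  set σ : ℤ := if 0 ≤ y i₀ then 1 else -1 with hσdef
  have hσ : σ = 1 ∨ σ = -1 := by rw [hσdef]; split_ifs <;> simp
  set sg : Fin d → ℤ := fun j => if 0 ≤ y j then 1 else -1 with hsg
  have hsg1 : ∀ j, sg j = 1 ∨ sg j = -1 := fun j => by simp only [hsg]; split_ifs <;> simp
  set Big : Finset (Fin d) := univ.filter fun j => j ≠ i₀ ∧ (2 * w : ℤ) ≤ |y j| with hBig
  set Small : Finset (Fin d) := univ.filter fun j => j ≠ i₀ ∧ |y j| < (2 * w : ℤ) with hSmall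
  -- the points of the chain: `a = y - z`, `b = y - x`
  set a : Site d := y - z with ha
  set b : Site d := y - x with hb
  -- coordinates of `a`
  have hyi : σ * y i₀ = Site.supNorm y := by
    rw [← hi₀, hσdef]; split_ifs with h
    · rw [one_mul]; exact (Int.natAbs_of_nonneg h).symm
    · rw [Int.ofNat_natAbs_of_nonpos (by linarith)]; ring
  have hzi : (m : ℤ) ≤ σ * z i₀ ∧ σ * z i₀ ≤ m + w := by
    have h := hz i₀
    unfold goodCorner at h
    simp only [if_true] at h
    rw [hσdef]
    split_ifs at h ⊢ with hs <;> constructor <;> linarith [h.1, h.2]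
  have hai : 2 * (m : ℤ) ≤ σ * a i₀ := by
    rw [ha, Pi.sub_apply, mul_sub, hyi]
    have : (4 * m : ℤ) ≤ Site.supNorm y := by exact_mod_cast hy
    have hwm' : (w : ℤ) ≤ m := by exact_mod_cast (show w ≤ m by omega)
    linarith [hzi.2]
  have haSmall : ∀ j ∈ Small, |a j| ≤ 3 * w := by
    intro j hj
    rw [hSmall, mem_filter] at hj
    have h := hz j
    unfold goodCorner at h
    rw [if_neg hj.2.1, if_neg (not_le.2 hj.2.2)] at h
    rw [ha, Pi.sub_apply, abs_le]
    have := abs_lt.1 hj.2.2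
    constructor <;> linarith [h.1, h.2]
  have haBig : ∀ j ∈ Big, 0 ≤ sg j * a j ∧ 0 ≤ sg j * (b j - a j) := by
    intro j hj
    rw [hBig, mem_filter] at hj
    have h := hz j
    unfold goodCorner at h
    rw [if_neg hj.2.1, if_pos hj.2.2] at h
    have hxj := hx j
    rw [ha, hb, Pi.sub_apply, Pi.sub_apply]
    simp only [hsg]
    have habs := hj.2.2
    split_ifs at h ⊢ with hs
    · rw [abs_of_nonneg hs] at habs
      constructor <;> nlinarith [h.1, h.2, hxj.1, hxj.2]
    · push Not at hs
      rw [abs_of_neg hs] at habs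
      constructor <;> nlinarith [h.1, h.2, hxj.1, hxj.2]
  -- Step A: the big transverse coordinates
  set a₁ : Site d := fun j => if j ∈ Big then b j else a j with ha₁
  have hA : twoPointFree d β a₁ ≤ twoPointFree d β a := by
    refine twoPointFree_le_of_axis_moves hβ sg a Big a₁ (fun j _ => hsg1 j) (fun j hj => (haBig j hj).1)
      (fun j hj => ?_) (fun j hj => ?_)
    · rw [ha₁]; simp only [hj, if_true]; exact (haBig j hj).2
    · rw [ha₁]; simp only [hj, if_false]
  -- Step B: the small transverse coordinates, paid along `i₀`
  set T : ℤ := ∑ j ∈ Small, |b j - a j| with hT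
  set a₂ : Site d := fun j => if j = i₀ then a i₀ + σ * T else if j ∈ Small then b j else a₁ j with ha₂
  have hi₀S : i₀ ∉ Small := by rw [hSmall, mem_filter]; simp
  have hi₀B : i₀ ∉ Big := by rw [hBig, mem_filter]; simp
  have ha₁i : a₁ i₀ = a i₀ := by rw [ha₁]; simp only [hi₀B, if_false]
  have ha₁S : ∀ j ∈ Small, a₁ j = a j := by
    intro j hj
    have : j ∉ Big := by
      rw [hSmall, mem_filter] at hj; rw [hBig, mem_filter]; push Not; intro _ _; exact hj.2.2
    rw [ha₁]; simp only [this, if_false]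
  have hB : twoPointFree d β a₂ ≤ twoPointFree d β a₁ := by
    refine twoPointFree_le_of_diag_moves hβ hσ a₁ Small a₂ hi₀S (fun j hj => ?_) ?_ (fun j hj hji => ?_)
    · rw [ha₁S j hj, ha₁i]
      have h3 : (3 * w : ℤ) ≤ 2 * m := by
        have : 3 * w ≤ 2 * m := by omega
        exact_mod_cast this
      linarith [haSmall j hj]
    · rw [ha₂]
      simp only [if_true]
      rw [ha₁i, hT]
      congr 1; congr 1
      exact Finset.sum_congr rfl fun j hj => by
        rw [if_neg (fun h : j = i₀ => hi₀S (h ▸ hj)), if_pos hj, ha₁S j hj]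
    · rw [ha₂]; simp only [hji, hj, if_false]
  -- Step C: the rest of the budget along `i₀`
  have hTle : T ≤ 2 * (d - 1 : ℕ) * w := by
    have hterm : ∀ j ∈ Small, |b j - a j| ≤ 2 * w := by
      intro j hj
      have h := hz j
      rw [hSmall, mem_filter] at hj
      unfold goodCorner at h
      rw [if_neg hj.2.1, if_neg (not_le.2 hj.2.2)] at h
      have hxj := hx j
      rw [ha, hb, Pi.sub_apply, Pi.sub_apply, abs_le]
      constructor <;> linarith [h.1, h.2]
    have hcard : #Small ≤ d - 1 := by
      have : Small ⊆ univ.erase i₀ := fun j hj => by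
        rw [hSmall, mem_filter] at hj; exact mem_erase.2 ⟨hj.2.1, mem_univ _⟩
      have h := card_le_card this
      rw [card_erase_of_mem (mem_univ _), card_univ, Fintype.card_fin] at h
      exact h
    calc T ≤ ∑ j ∈ Small, (2 * w : ℤ) := Finset.sum_le_sum hterm
      _ = #Small * (2 * w : ℤ) := by rw [Finset.sum_const, nsmul_eq_mul]
      _ ≤ (d - 1 : ℕ) * (2 * w : ℤ) := by gcongr
      _ = 2 * (d - 1 : ℕ) * w := by ring
  have hbudget : 0 ≤ σ * (b i₀ - a₂ i₀) := by
    have ha₂i : a₂ i₀ = a i₀ + σ * T := by rw [ha₂]; simp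
    rw [ha₂i, hb, ha, Pi.sub_apply, Pi.sub_apply]
    have hσσ : σ * σ = 1 := by rcases hσ with h | h <;> rw [h] <;> norm_num
    have hxi : σ * x i₀ ≤ w := by
      have hxj := hx i₀
      rcases hσ with h | h <;> rw [h] <;> linarith [hxj.1, hxj.2]
    have h1 : σ * (y i₀ - x i₀ - (y i₀ - z i₀ + σ * T)) = σ * z i₀ - σ * x i₀ - σ * σ * T := by ring
    rw [h1, hσσ, one_mul]
    have hdw : (2 * (d - 1 : ℕ) * w : ℤ) + w ≤ m := by
      have h1 : ((d - 1 : ℕ) : ℤ) = d - 1 := by push_cast [Nat.cast_sub hd]; ring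
      have h2 : (2 * d * w : ℤ) ≤ m := by exact_mod_cast hw
      have h3 : (0 : ℤ) ≤ w := by positivity
      rw [h1]; nlinarith
    linarith [hzi.1]
  have hC : twoPointFree d β b ≤ twoPointFree d β a₂ := by
    set t : ℕ := (σ * (b i₀ - a₂ i₀)).toNat with ht
    have htq : (t : ℤ) = σ * (b i₀ - a₂ i₀) := by rw [ht, Int.toNat_of_nonneg hbudget]
    have hσσ : σ * σ = 1 := by rcases hσ with h | h <;> rw [h] <;> norm_num
    have heq : b = a₂ + Pi.single i₀ (σ * t) := by
      ext k
      by_cases hk : k = i₀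
      · subst hk
        rw [Pi.add_apply, Pi.single_eq_same, htq, ← mul_assoc, hσσ, one_mul]; ring
      · rw [Pi.add_apply, Pi.single_eq_of_ne hk, add_zero, ha₂]
        simp only [hk, if_false]
        by_cases hkS : k ∈ Small
        · rw [if_pos hkS]
        · rw [if_neg hkS, ha₁]
          dsimp only
          by_cases hkB : k ∈ Big
          · rw [if_pos hkB]
          · -- every `k ≠ i₀` is big or small
            exfalso
            rw [hBig, mem_filter] at hkB
            rw [hSmall, mem_filter] at hkS
            push Not at hkB hkS
            exact absurd (hkS (mem_univ _) hk) (not_le.2 (hkB (mem_univ _) hk))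
    have ha₂i : 0 ≤ σ * a₂ i₀ := by
      have : a₂ i₀ = a i₀ + σ * T := by rw [ha₂]; simp
      rw [this, mul_add, ← mul_assoc, hσσ, one_mul]
      have hT0 : 0 ≤ T := Finset.sum_nonneg fun j _ => abs_nonneg _
      have : (0 : ℤ) ≤ 2 * m := by positivity
      linarith
    have h := twoPointFree_add_single_signed_le hβ a₂ i₀ hσ ha₂i t
    rw [← heq] at h
    exact h
  exact hC.trans (hB.trans hA)

end Literature.Probability.LatticeModels
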